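import Literature.Topology.FourManifolds.TrisectionsSectorNormalForm
import Literature.Topology.FourManifolds.TrisectionsAmbientMorse
import HarnessLib

/-!
# Renormalising an ambient presentation to the retraction (corner coefficient made constant
# along the normal fibres)

Topic `Literature/Topology/FourManifolds`; infrastructure for the fact seat
`provefact-Literature.Topology.FourManifolds.exists-14560f9fc8` (named fact (c′)
`Literature.Topology.FourManifolds.exists_stabilized_gkTrisection`, Gay–Kirby 2016, Def. 8 and
Lemma 10).  Everything in this file is **proved**; no definitions, no named facts.

After the implant of the stabilisation surgery the new sectors come with ambient functions of
corner form `G = 1 - 2uv · κ` near the new central surface, but `κ` is no longer constant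
along the fibres of the (new) retraction `ρ`, as clause `κ ∘ ρ = κ` of
`SectorNormalForm.morse` (`TrisectionsSectorNormalForm.lean`) demands (the straightened corner
charts `cornerFold ∘ Θ` only see functions of the tangential coordinates smoothly).

**Theorem (`sectorNormalForm_of_rawPresentation`).**  *Let `(F, u, v, ρ, U, O)` be a normal
frame, `S` compact and `= {u, v ≥ 0}` in `U` with interior `{u, v > 0}` there, with
corner-slice charts along `F` (sources in `O`) and half-slice charts off `F`, and let `G, κ`
be smooth with `κ > 0` and `G = 1 - 2uv·κ` on an open `Oκ`, `F ⊆ Oκ ⊆ O`, `G = 1` at the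
non-interior points of `S`, `< 1` at the interior ones, regular at the non-interior points off
`F`, nondegenerate at the interior critical points, `c n` of them of index `n`.  Then `S` is a
`SectorNormalForm` for the frame with counts `c`.*

**Proof** (the interpolation of `TrisectionsAmbientMorse.lean`, abstracted).  Put
`G″ = G + 2uv·χ·(κ - κ ∘ ρ) = 1 - 2uv[(1 - χ)κ + χ κ ∘ ρ]` with the localised cutoff
`χ = χ₁((u² + v²)/η)` (`exists_localised_cutoff'`).  Near `F` (`χ = 1`) this is the corner form
with the `ρ`-invariant coefficient `κ ∘ ρ`; far away `G″ = G` locally; in the zone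
`{u² + v² ≤ η}` neither `G″` nor `G` has critical points on `S ∖ F` for `η` small
(`hasDerivAt_interp_line_neg(')` with the constants of `exists_uniform_chart_constants`, the
second time with the zero profile), so all clauses transfer, including the counts.

## References

* D. Gay, R. Kirby, *Trisecting 4-manifolds*, Geom. Topol. 20 (2016) 3097–3132, Def. 1 and
  Def. 8. [GayKirby2016]
* J. Milnor, *Morse theory* (1963), §§2–3. [Milnor1963]
-/

open scoped Manifold ContDiff Topology
open Set Function Filter

noncomputable section

namespace Literature.Topology.FourManifolds

universe u

section Renormalise

variable {X : Type u} [TopologicalSpace X] [T2Space X] [CompactSpace X]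
  [ChartedSpace (EuclideanSpace ℝ (Fin 4)) X] [IsManifold (𝓡 4) ∞ X]
  {S F : Set X} {u v : X → ℝ} {ρ : X → X} {U O : Set X}

omit [T2Space X] [CompactSpace X] in
/-- **No critical points in the thin zone** (the line-derivative estimate of
`TrisectionsAmbientMorse.lean`, abstracted over the profile).  Let `Gx` be smooth and read, in
every corner-slice chart `Cc` and at the points `z` of the target over `V₁` with `z₀, z₁ ≥ 0`,
as `1 - 2 z₀ z₁ [(1 - χp(r²/η)) K(Cc.Θ⁻¹ z) + χp(r²/η) K(Cc.Θ⁻¹(stratumProj z))]`, where the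
profile `χp` is differentiable with values in `[0, 1]` and `|χp'| ≤ Cp`, and the uniform
constants `m, C` of `K` over the charts satisfy `√η · C(1 + 2Cp) < m`.  Then `Gx` has no
critical point on `S ∖ F` inside `V₁ ∩ {u² + v² ≤ η}`. [cite: Milnor1963, §§2–3] -/
theorem not_isMCriticalPt_near (hfr : NormalFrame F u v ρ U O)
    (hSi : ∀ y ∈ U, y ∈ S ↔ 0 ≤ u y ∧ 0 ≤ v y)
    {V₁ : Set X} (hV₁o : IsOpen V₁) (hV₁U : V₁ ⊆ U)
    {K : X → ℝ} {m C η₁ η : ℝ} (hC : 0 ≤ C) (hη : 0 < η) (hηη₁ : η ≤ η₁)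
    (hconst : ∀ y ∈ S ∩ closure V₁, u y ^ 2 + v y ^ 2 ≤ η₁ →
        ∃ (Cc : CornerSliceChart S F u v ρ) (qm : EuclideanSpace ℝ (Fin 4)) (R : ℝ),
          y ∈ Cc.Θ.source ∧ Cc.Θ y ∈ Metric.ball qm R ∧ Metric.ball qm R ⊆ Cc.Θ.target ∧
          qm 0 = 0 ∧ qm 1 = 0 ∧ (∀ z ∈ Metric.ball qm R, Cc.Θ.symm z ∈ O) ∧
          ∀ z ∈ Metric.ball qm R, DifferentiableAt ℝ (K ∘ Cc.Θ.symm) z ∧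
            ‖fderiv ℝ (K ∘ Cc.Θ.symm) z‖ ≤ C ∧ m ≤ K (Cc.Θ.symm z))
    {χp : ℝ → ℝ} (hχpd : Differentiable ℝ χp) {Cp : ℝ} (hCp : 0 ≤ Cp)
    (hχpC : ∀ x, |deriv χp x| ≤ Cp) (hχp01 : ∀ x, 0 ≤ χp x ∧ χp x ≤ 1)
    (hηsmall : Real.sqrt η * (C * (1 + 2 * Cp)) < m)
    {Gx : X → ℝ} (hGxs : ContMDiff (𝓡 4) 𝓘(ℝ, ℝ) ∞ Gx)
    (hchartformula : ∀ (Cc : CornerSliceChart S F u v ρ) (z : EuclideanSpace ℝ (Fin 4)),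
      z ∈ Cc.Θ.target → 0 ≤ z 0 → 0 ≤ z 1 → Cc.Θ.symm z ∈ V₁ →
      Gx (Cc.Θ.symm z) = 1 - 2 * z 0 * z 1 *
        ((1 - χp ((z 0 ^ 2 + z 1 ^ 2) / η)) * K (Cc.Θ.symm z) +
          χp ((z 0 ^ 2 + z 1 ^ 2) / η) * K (Cc.Θ.symm (stratumProj z)))) :
    ∀ y ∈ S, y ∉ F → y ∈ V₁ → u y ^ 2 + v y ^ 2 ≤ η → ¬ IsMCriticalPt (𝓡 4) Gx y := by
  intro y hyS hyF hyV₁ hyr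
  have hyU : y ∈ U := hV₁U hyV₁
  have hF := hfr.memF_iff
  obtain ⟨hu0, hv0⟩ := (hSi y hyU).1 hyS
  obtain ⟨Cc, qm, R, hysrc, hyball, hballT, hqm0, hqm1, -, hbds⟩ :=
    hconst y ⟨hyS, subset_closure hyV₁⟩ (hyr.trans hηη₁)
  set q : EuclideanSpace ℝ (Fin 4) := Cc.Θ y with hq
  have hq0 : q 0 = u y := Cc.apply_zero y hysrc
  have hq1 : q 1 = v y := Cc.apply_one y hysrc
  have hqtgt : q ∈ Cc.Θ.target := Cc.Θ.map_source hysrc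
  have hsymmq : Cc.Θ.symm q = y := Cc.Θ.left_inv hysrc
  -- not both normal coordinates vanish
  have hne : ¬ (u y = 0 ∧ v y = 0) := fun h0 => hyF ((hF y hyU).2 h0)
  -- `G` read in the chart
  set Gh : EuclideanSpace ℝ (Fin 4) → ℝ := Gx ∘ Cc.Θ.symm with hGh
  have hGhs : ContDiffAt ℝ ∞ Gh q := by
    have h1 : ContMDiffOn 𝓘(ℝ, EuclideanSpace ℝ (Fin 4)) 𝓘(ℝ, ℝ) ∞ Gh Cc.Θ.target :=
      hGxs.comp_contMDiffOn Cc.contMDiffOn_symm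
    exact (contMDiffOn_iff_contDiffOn.mp h1).contDiffAt (Cc.Θ.open_target.mem_nhds hqtgt)
  have hGhd : DifferentiableAt ℝ Gh q := hGhs.differentiableAt (by simp)
  -- the Morse-critical point condition read in the chart `Cc.Θ`
  have hmem2 : Cc.Θ ∈ IsManifold.maximalAtlas (𝓡 4) 2 X :=
    IsManifold.maximalAtlas_subset_of_le (M := X) (I := 𝓡 4) ENat.LEInfty.out
      Cc.Θ_mem_maximalAtlas
  have hcrit_iff : IsMCriticalPt (𝓡 4) Gx y ↔ fderiv ℝ Gh q = 0 := by
    rw [isMCriticalPt_iff_fderiv_comp_extend_symm_eq_zero (I := 𝓡 4)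
      ((hGxs.contMDiffAt (x := y)).of_le ENat.LEInfty.out) hmem2 hysrc]
    have h1 : (Gx ∘ (Cc.Θ.extend (𝓡 4)).symm) = Gh := by ext z; simp [hGh]
    have h2 : Cc.Θ.extend (𝓡 4) y = q := by simp [hq]
    rw [h1, h2]
  rw [hcrit_iff]
  -- constants and bounds in the ball
  have hKd' : ∀ z ∈ Metric.ball qm R, DifferentiableAt ℝ (K ∘ Cc.Θ.symm) z :=
    fun z hz => (hbds z hz).1
  have hKC' : ∀ z ∈ Metric.ball qm R, ‖fderiv ℝ (K ∘ Cc.Θ.symm) z‖ ≤ C :=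
    fun z hz => (hbds z hz).2.1
  have hKm' : ∀ z ∈ Metric.ball qm R, m ≤ (K ∘ Cc.Θ.symm) z := fun z hz => (hbds z hz).2.2
  -- points of the line stay in the good region
  have hV₁near : ∀ᶠ z in 𝓝 q, z ∈ Metric.ball qm R ∧ Cc.Θ.symm z ∈ V₁ := by
    have h1 : ∀ᶠ z in 𝓝 q, z ∈ Metric.ball qm R := Metric.isOpen_ball.mem_nhds hyball
    have h2 : ∀ᶠ z in 𝓝 q, Cc.Θ.symm z ∈ V₁ := by
      have hc : ContinuousAt Cc.Θ.symm q := Cc.Θ.continuousAt_symm hqtgt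
      apply hc.preimage_mem_nhds
      rw [hsymmq]; exact hV₁o.mem_nhds hyV₁
    exact h1.and h2
  by_cases hv : 0 < v y
  · -- move in the `u`-direction
    set e0 : EuclideanSpace ℝ (Fin 4) := EuclideanSpace.single 0 (1:ℝ) with he0
    have ha : ∀ s : ℝ, (q + s • e0) 0 = q 0 + s := fun s => by simp [he0]
    have hb : ∀ s : ℝ, (q + s • e0) 1 = q 1 := fun s => by simp [he0]
    have hsP : ∀ s : ℝ, stratumProj (q + s • e0) = stratumProj q := fun s => by
      ext i'; fin_cases i' <;> simp [stratumProj, he0]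
    obtain ⟨g', hg'neg, hg'⟩ := hasDerivAt_interp_line_neg (Kh := K ∘ Cc.Θ.symm)
      (χ₁ := χp) (η := η) (qm := qm) (q := q)
      hKd' hKC' hKm' hC hχpd hχpC hχp01 hCp ⟨hqm0, hqm1⟩ hyball
      (by rw [hq0]; exact hu0) (by rw [hq1]; exact hv) hη (by rw [hq0, hq1]; exact hyr) hηsmall
    have hline : Tendsto (fun s : ℝ => q + s • e0) (𝓝 0) (𝓝 q) := by
      have : Continuous fun s : ℝ => q + s • e0 := by fun_prop
      simpa using this.tendsto 0
    have heq : ∀ᶠ s in 𝓝[≥] (0:ℝ), Gh (q + s • e0) = 1 - 2 * (q 0 + s) * q 1 *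
        ((1 - χp (((q 0 + s) ^ 2 + q 1 ^ 2) / η)) *
            (K ∘ Cc.Θ.symm) (q + s • e0) +
          χp (((q 0 + s) ^ 2 + q 1 ^ 2) / η) *
            (K ∘ Cc.Θ.symm) (stratumProj q)) := by
      filter_upwards [(hline.eventually hV₁near).filter_mono nhdsWithin_le_nhds,
        self_mem_nhdsWithin] with s hs hs0
      have hs0' : (0:ℝ) ≤ s := hs0
      have h := hchartformula Cc (q + s • e0) (hballT hs.1) (by rw [ha, hq0]; linarith)
        (by rw [hb, hq1]; exact hv0) hs.2
      simp only [hGh, comp_apply]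
      rw [h, ha, hb, hsP]
    exact fderiv_ne_zero_of_eventuallyEq_line hGhd hg' hg'neg.ne heq
  · -- `v y = 0`, so `u y > 0`: move in the `v`-direction
    have hv0' : v y = 0 := le_antisymm (not_lt.1 hv) hv0
    have hu : 0 < u y := lt_of_le_of_ne hu0 fun h0 => hne ⟨h0.symm, hv0'⟩
    set e1 : EuclideanSpace ℝ (Fin 4) := EuclideanSpace.single 1 (1:ℝ) with he1
    have ha : ∀ s : ℝ, (q + s • e1) 1 = q 1 + s := fun s => by simp [he1]
    have hb : ∀ s : ℝ, (q + s • e1) 0 = q 0 := fun s => by simp [he1]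
    have hsP : ∀ s : ℝ, stratumProj (q + s • e1) = stratumProj q := fun s => by
      ext i'; fin_cases i' <;> simp [stratumProj, he1]
    obtain ⟨g', hg'neg, hg'⟩ := hasDerivAt_interp_line_neg' (Kh := K ∘ Cc.Θ.symm)
      (χ₁ := χp) (η := η) (qm := qm) (q := q)
      hKd' hKC' hKm' hC hχpd hχpC hχp01 hCp ⟨hqm0, hqm1⟩ hyball
      (by rw [hq1]; exact hv0) (by rw [hq0]; exact hu) hη (by rw [hq0, hq1, add_comm]; exact hyr)
      hηsmall
    have hline : Tendsto (fun s : ℝ => q + s • e1) (𝓝 0) (𝓝 q) := by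
      have : Continuous fun s : ℝ => q + s • e1 := by fun_prop
      simpa using this.tendsto 0
    have heq : ∀ᶠ s in 𝓝[≥] (0:ℝ), Gh (q + s • e1) = 1 - 2 * (q 1 + s) * q 0 *
        ((1 - χp (((q 1 + s) ^ 2 + q 0 ^ 2) / η)) *
            (K ∘ Cc.Θ.symm) (q + s • e1) +
          χp (((q 1 + s) ^ 2 + q 0 ^ 2) / η) *
            (K ∘ Cc.Θ.symm) (stratumProj q)) := by
      filter_upwards [(hline.eventually hV₁near).filter_mono nhdsWithin_le_nhds,
        self_mem_nhdsWithin] with s hs hs0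
      have hs0' : (0:ℝ) ≤ s := hs0
      have h := hchartformula Cc (q + s • e1) (hballT hs.1) (by rw [hb, hq0]; exact hu0)
        (by rw [ha, hq1]; linarith) hs.2
      simp only [hGh, comp_apply]
      rw [h, ha, hb, hsP]
      ring_nf
    exact fderiv_ne_zero_of_eventuallyEq_line hGhd hg' hg'neg.ne heq

/-- **Renormalising a raw ambient presentation to the retraction.**  See the module docstring.
[cite: GayKirby2016, Def. 1 and Def. 8; Milnor1963, §§2–3] -/
theorem sectorNormalForm_of_rawPresentation (hfr : NormalFrame F u v ρ U O) (hSc : IsCompact S)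
    (hmem : ∀ y ∈ U, y ∈ S ↔ 0 ≤ u y ∧ 0 ≤ v y)
    (hint : ∀ y ∈ U, y ∈ S → (y ∈ interior S ↔ 0 < u y ∧ 0 < v y))
    (hcorner : ∀ x ∈ F, ∃ C : CornerSliceChart S F u v ρ, x ∈ C.Θ.source ∧ C.Θ.source ⊆ O)
    (hhalf : ∀ p ∈ S, p ∉ F → ∃ D : HalfSliceChart (𝓡 4) S, p ∈ D.Θ.source ∧ ∀ q ∈ D.Θ.source, q ∉ F)
    {G κ : X → ℝ} {Oκ : Set X} (hGs : ContMDiff (𝓡 4) 𝓘(ℝ, ℝ) ∞ G)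
    (hκs : ContMDiff (𝓡 4) 𝓘(ℝ, ℝ) ∞ κ) (hOκo : IsOpen Oκ) (hFOκ : F ⊆ Oκ) (hOκO : Oκ ⊆ O)
    (hκpos : ∀ y ∈ Oκ, 0 < κ y) (hGform : ∀ y ∈ Oκ, G y = 1 - 2 * u y * v y * κ y)
    (hb1 : ∀ p ∈ S, p ∉ interior S → G p = 1) (hi1 : ∀ p ∈ interior S, G p < 1)
    (hb2 : ∀ p ∈ S, p ∉ interior S → p ∉ F → ¬ IsMCriticalPt (𝓡 4) G p)
    (hi2 : ∀ p ∈ interior S, IsMCriticalPt (𝓡 4) G p → (mhessian (𝓡 4) G p).Nondegenerate)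
    {c : ℕ → ℕ} (hc : ∀ n, (interior S ∩ criticalSetOfIndex (𝓡 4) G n).ncard = c n) :
    SectorNormalForm S F u v ρ U O c := by
  have hFc : IsCompact F := hfr.isCompact_F
  have hFclosed : IsClosed F := hFc.isClosed
  have hFU : F ⊆ U := hfr.F_subset_U
  have hOU : Oκ ⊆ U := hOκO.trans hfr.O_subset_U
  have hF := hfr.memF_iff
  have hu := hfr.contMDiff_u
  have hv := hfr.contMDiff_v
  have hρs := hfr.contMDiff_ρ
  -- points of `F` are not interior to `S`
  have hFnotint : ∀ x ∈ F, x ∉ interior S := fun x hx => by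
    obtain ⟨C, hxC, -⟩ := hcorner x hx
    exact C.not_mem_interior_of_mem_K hxC hx
  -- ### the cutoff data on `V := Oκ`
  have hVzero : ∀ y ∈ Oκ, u y = 0 → v y = 0 → y ∈ F := fun y hy hu0 hv0 =>
    (hF y (hOU hy)).2 ⟨hu0, hv0⟩
  obtain ⟨V₁, η₀, hV₁o, hFV₁, hclV₁, hη₀, hfront, hcut⟩ :=
    exists_localised_cutoff' hFclosed hOκo hFOκ hu hv hVzero
  have hV₁V : V₁ ⊆ Oκ := subset_closure.trans hclV₁
  have hV₁U : V₁ ⊆ U := hV₁V.trans hOU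
  -- ### uniform chart constants on `S ∩ closure V₁`
  have hcd : ∀ x ∈ F, ∃ C : CornerSliceChart S F u v ρ, x ∈ C.Θ.source := fun x hx => by
    obtain ⟨C, hxC, -⟩ := hcorner x hx; exact ⟨C, hxC⟩
  have hZ₀c : IsCompact (S ∩ closure V₁) := hSc.inter_right isClosed_closure
  have hzeroF : ∀ y ∈ S ∩ closure V₁, u y = 0 → v y = 0 → y ∈ F := fun y hy hu0 hv0 =>
    hVzero y (hclV₁ hy.2) hu0 hv0
  obtain ⟨m, C, η₁, hm, hC, hη₁, hconst⟩ := exists_uniform_chart_constants hFc hcd hκs hOκo hFOκ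
    hκpos hu.continuous hv.continuous hZ₀c hzeroF
  -- ### the profile and the choice of `η`
  obtain ⟨hχ₁s, hχ₁01, hχ₁one, hχ₁zero, Cχ, hCχ, hχ₁C⟩ := cutoffProfile_props
  obtain ⟨η, hη, hηη₀, hηη₁, hηsmall⟩ : ∃ η : ℝ, 0 < η ∧ η ≤ η₀ ∧ η ≤ η₁ ∧
      Real.sqrt η * (C * (1 + 2 * Cχ)) < m := by
    set A : ℝ := C * (1 + 2 * Cχ) with hA
    have hA0 : 0 ≤ A := by positivity
    set s₀ : ℝ := m / (2 * (A + 1)) with hs₀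
    have hs₀pos : 0 < s₀ := by positivity
    set η' : ℝ := min (min η₀ η₁) (s₀ ^ 2) with hη'
    refine ⟨η', lt_min (lt_min hη₀ hη₁) (by positivity),
      (min_le_left _ _).trans (min_le_left _ _), (min_le_left _ _).trans (min_le_right _ _), ?_⟩
    have h1 : Real.sqrt η' ≤ s₀ := by
      calc Real.sqrt η' ≤ Real.sqrt (s₀ ^ 2) := Real.sqrt_le_sqrt (min_le_right _ _)
        _ = s₀ := Real.sqrt_sq hs₀pos.le
    calc Real.sqrt η' * A ≤ s₀ * A := mul_le_mul_of_nonneg_right h1 hA0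
      _ = m * (A / (2 * (A + 1))) := by rw [hs₀]; ring
      _ < m * 1 := by
          refine mul_lt_mul_of_pos_left ?_ hm
          rw [div_lt_one (by positivity)]; linarith
      _ = m := mul_one m
  have hηsmall0 : Real.sqrt η * (C * (1 + 2 * 0)) < m := by
    refine lt_of_le_of_lt ?_ hηsmall
    refine mul_le_mul_of_nonneg_left ?_ (Real.sqrt_nonneg _)
    exact mul_le_mul_of_nonneg_left (by linarith) hC
  -- ### the cutoff `χ`
  obtain ⟨χ, hχs, hχ01, hχV₁, hχout⟩ := hcut η hη hηη₀
  set r2 : X → ℝ := fun y => u y ^ 2 + v y ^ 2 with hr2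
  have hr2s : ContMDiff (𝓡 4) 𝓘(ℝ, ℝ) ∞ r2 := (hu.pow 2).add (hv.pow 2)
  -- ### the renormalised function
  set Gn : X → ℝ := fun y => G y + 2 * u y * v y * (χ y * (κ y - κ (ρ y))) with hGn
  have hGns : ContMDiff (𝓡 4) 𝓘(ℝ, ℝ) ∞ Gn :=
    hGs.add (((contMDiff_const.mul hu).mul hv).mul (hχs.mul (hκs.sub (hκs.comp hρs))))
  -- the formula on `V₁`
  have hformula : ∀ y ∈ V₁, Gn y = 1 - 2 * u y * v y * ((1 - χ y) * κ y + χ y * κ (ρ y)) := by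
    intro y hy
    simp only [hGn]
    rw [hGform y (hV₁V hy)]
    ring
  -- ### the chart formulas (for `Gn` and for `G`)
  have hchartformula : ∀ (Cc : CornerSliceChart S F u v ρ) (z : EuclideanSpace ℝ (Fin 4)),
      z ∈ Cc.Θ.target → 0 ≤ z 0 → 0 ≤ z 1 → Cc.Θ.symm z ∈ V₁ →
      Gn (Cc.Θ.symm z) = 1 - 2 * z 0 * z 1 *
        ((1 - Real.smoothTransition (2 - 2 * ((z 0 ^ 2 + z 1 ^ 2) / η))) * κ (Cc.Θ.symm z) +
          Real.smoothTransition (2 - 2 * ((z 0 ^ 2 + z 1 ^ 2) / η)) *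
            κ (Cc.Θ.symm (stratumProj z))) := by
    intro Cc z hz _ _ hzV₁
    set y := Cc.Θ.symm z with hy
    have hysrc : y ∈ Cc.Θ.source := Cc.Θ.map_target hz
    have hΘy : Cc.Θ y = z := Cc.Θ.right_inv hz
    have huy : u y = z 0 := by rw [← Cc.apply_zero y hysrc, hΘy]
    have hvy : v y = z 1 := by rw [← Cc.apply_one y hysrc, hΘy]
    have hχy : χ y = Real.smoothTransition (2 - 2 * ((z 0 ^ 2 + z 1 ^ 2) / η)) := by
      rw [hχV₁ y hzV₁, huy, hvy]
    have hρy : κ (ρ y) = κ (Cc.Θ.symm (stratumProj z)) := by rw [hy, Cc.π_symm_eq hz]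
    rw [hformula y hzV₁, huy, hvy, hχy, hρy]
  have hchartformula0 : ∀ (Cc : CornerSliceChart S F u v ρ) (z : EuclideanSpace ℝ (Fin 4)),
      z ∈ Cc.Θ.target → 0 ≤ z 0 → 0 ≤ z 1 → Cc.Θ.symm z ∈ V₁ →
      G (Cc.Θ.symm z) = 1 - 2 * z 0 * z 1 *
        ((1 - (fun _ : ℝ => (0:ℝ)) ((z 0 ^ 2 + z 1 ^ 2) / η)) * κ (Cc.Θ.symm z) +
          (fun _ : ℝ => (0:ℝ)) ((z 0 ^ 2 + z 1 ^ 2) / η) * κ (Cc.Θ.symm (stratumProj z))) := by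
    intro Cc z hz _ _ hzV₁
    set y := Cc.Θ.symm z with hy
    have hysrc : y ∈ Cc.Θ.source := Cc.Θ.map_target hz
    have hΘy : Cc.Θ y = z := Cc.Θ.right_inv hz
    have huy : u y = z 0 := by rw [← Cc.apply_zero y hysrc, hΘy]
    have hvy : v y = z 1 := by rw [← Cc.apply_one y hysrc, hΘy]
    rw [hGform y (hV₁V hzV₁), huy, hvy]
    simp
  -- ### no critical points in the thin zone, for `Gn` and for `G`
  have hconst' : ∀ y ∈ S ∩ closure V₁, u y ^ 2 + v y ^ 2 ≤ η₁ →
      ∃ (Cc : CornerSliceChart S F u v ρ) (qm : EuclideanSpace ℝ (Fin 4)) (R : ℝ),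
        y ∈ Cc.Θ.source ∧ Cc.Θ y ∈ Metric.ball qm R ∧ Metric.ball qm R ⊆ Cc.Θ.target ∧
        qm 0 = 0 ∧ qm 1 = 0 ∧ (∀ z ∈ Metric.ball qm R, Cc.Θ.symm z ∈ O) ∧
        ∀ z ∈ Metric.ball qm R, DifferentiableAt ℝ (κ ∘ Cc.Θ.symm) z ∧
          ‖fderiv ℝ (κ ∘ Cc.Θ.symm) z‖ ≤ C ∧ m ≤ κ (Cc.Θ.symm z) := by
    intro y hy hyr
    obtain ⟨Cc, qm, R, h1, h2, h3, h4, h5, h6, h7⟩ := hconst y hy hyr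
    exact ⟨Cc, qm, R, h1, h2, h3, h4, h5, fun z hz => hOκO (h6 z hz), h7⟩
  have hχd : Differentiable ℝ fun x : ℝ => Real.smoothTransition (2 - 2 * x) :=
    hχ₁s.differentiable (by simp)
  have hnear : ∀ y ∈ S, y ∉ F → y ∈ V₁ → u y ^ 2 + v y ^ 2 ≤ η → ¬ IsMCriticalPt (𝓡 4) Gn y :=
    not_isMCriticalPt_near hfr hmem hV₁o hV₁U hC hη hηη₁ hconst' hχd hCχ hχ₁C hχ₁01 hηsmall hGns
      hchartformula
  have hnear0 : ∀ y ∈ S, y ∉ F → y ∈ V₁ → u y ^ 2 + v y ^ 2 ≤ η → ¬ IsMCriticalPt (𝓡 4) G y :=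
    not_isMCriticalPt_near hfr hmem hV₁o hV₁U hC hη hηη₁ hconst' (differentiable_const _) le_rfl
      (fun x => by simp) (fun x => by simp) hηsmall0 hGs hchartformula0
  -- ### far from `F`: the cutoff vanishes identically, `Gn = G` locally
  have hfarN : ∀ y, (y ∉ V₁ ∨ η < r2 y) → ∃ N : Set X, IsOpen N ∧ y ∈ N ∧ ∀ z ∈ N, χ z = 0 := by
    intro y hy
    have hbig : ∀ z, η < r2 z → χ z = 0 := by
      intro z hz
      by_cases hzV₁ : z ∈ V₁
      · rw [hχV₁ z hzV₁]
        exact hχ₁zero _ (by rw [le_div_iff₀ hη]; simp only [hr2] at hz; linarith)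
      · exact hχout z hzV₁
    rcases hy with hyV₁ | hyr
    · by_cases hycl : y ∈ closure V₁
      · have hr : η₀ < r2 y := hfront y hycl hyV₁
        refine ⟨r2 ⁻¹' Ioi η, isOpen_Ioi.preimage hr2s.continuous, ?_, fun z hz => hbig z hz⟩
        show η < r2 y; linarith
      · exact ⟨(closure V₁)ᶜ, isClosed_closure.isOpen_compl, hycl, fun z hz =>
          hχout z fun hzV₁ => hz (subset_closure hzV₁)⟩
    · exact ⟨r2 ⁻¹' Ioi η, isOpen_Ioi.preimage hr2s.continuous, hyr, fun z hz => hbig z hz⟩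
  have hfar : ∀ y, (y ∉ V₁ ∨ η < r2 y) → Gn =ᶠ[𝓝 y] fun w => G w + 0 := by
    intro y hy
    obtain ⟨N, hNo, hyN, hN⟩ := hfarN y hy
    filter_upwards [hNo.mem_nhds hyN] with w hw
    simp only [hGn, hN w hw, zero_mul, mul_zero, add_zero]
  have hdich : ∀ y, (y ∈ V₁ ∧ r2 y ≤ η) ∨ (y ∉ V₁ ∨ η < r2 y) := by
    intro y
    by_cases h1 : y ∈ V₁
    · by_cases h2 : r2 y ≤ η
      · exact Or.inl ⟨h1, h2⟩
      · exact Or.inr (Or.inr (not_le.1 h2))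
    · exact Or.inr (Or.inl h1)
  -- ### the region of the corner form and the new coefficient `κ ∘ ρ`
  set Oκ' : Set X := V₁ ∩ r2 ⁻¹' Iio (η / 2) with hOκ'
  have hOκ'o : IsOpen Oκ' := hV₁o.inter (isOpen_Iio.preimage hr2s.continuous)
  have hFOκ' : F ⊆ Oκ' := fun x hx => ⟨hFV₁ hx, by
    obtain ⟨hu0, hv0⟩ := (hF x (hFU hx)).1 hx
    show r2 x < η / 2; simp only [hr2, hu0, hv0]; norm_num; linarith⟩
  have hOκ'O : Oκ' ⊆ O := fun y hy => hOκO (hV₁V hy.1)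
  have hχone : ∀ y ∈ Oκ', χ y = 1 := by
    rintro y ⟨hyV₁, hyr⟩
    rw [hχV₁ y hyV₁]
    apply hχ₁one
    have : r2 y < η / 2 := hyr
    rw [div_le_iff₀ hη]; simp only [hr2] at this; linarith
  -- ### the clauses
  have huvzero : ∀ y ∈ S, y ∈ U → y ∉ interior S → u y * v y = 0 := by
    intro y hyS hyU hnot
    obtain ⟨hu0, hv0⟩ := (hmem y hyU).1 hyS
    by_contra hne
    have hu' : 0 < u y := lt_of_le_of_ne hu0 fun h0 => hne (by rw [← h0, zero_mul])
    have hv' : 0 < v y := lt_of_le_of_ne hv0 fun h0 => hne (by rw [← h0, mul_zero])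
    exact hnot ((hint y hyU hyS).2 ⟨hu', hv'⟩)
  have hb1' : ∀ p ∈ S, p ∉ interior S → Gn p = 1 := by
    intro p hpS hnot
    by_cases hpU : p ∈ U
    · show G p + 2 * u p * v p * (χ p * (κ p - κ (ρ p))) = 1
      rw [hb1 p hpS hnot, mul_assoc 2 (u p) (v p), huvzero p hpS hpU hnot]; ring
    · have hpV₁ : p ∉ V₁ := fun h => hpU (hV₁U h)
      show G p + 2 * u p * v p * (χ p * (κ p - κ (ρ p))) = 1
      rw [hχout p hpV₁, hb1 p hpS hnot]; ring
  have hi1' : ∀ p ∈ interior S, Gn p < 1 := by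
    intro p hpint
    have hpS : p ∈ S := interior_subset hpint
    by_cases hpV₁ : p ∈ V₁
    · rw [hformula p hpV₁]
      have hpU : p ∈ U := hV₁U hpV₁
      obtain ⟨hu', hv'⟩ := (hint p hpU hpS).1 hpint
      have hκ1 : 0 < κ p := hκpos _ (hV₁V hpV₁)
      have hκ2 : 0 < κ (ρ p) := hκpos _ (hFOκ (hfr.ρ_mem _ (hOκO (hV₁V hpV₁))))
      have hχp := hχ01 p
      have hmix : 0 < (1 - χ p) * κ p + χ p * κ (ρ p) := by
        rcases hχp.1.lt_or_eq with hlt | heq0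
        · nlinarith
        · rw [← heq0]; simpa using hκ1
      nlinarith [mul_pos (mul_pos hu' hv') hmix]
    · show G p + 2 * u p * v p * (χ p * (κ p - κ (ρ p))) < 1
      rw [hχout p hpV₁]; simpa using hi1 p hpint
  have hb2' : ∀ p ∈ S, p ∉ interior S → p ∉ F → ¬ IsMCriticalPt (𝓡 4) Gn p := by
    intro p hpS hnot hpF
    rcases hdich p with ⟨hV₁, hr⟩ | hfarp
    · exact hnear p hpS hpF hV₁ hr
    · rw [isMCriticalPt_congr_of_eventuallyEq_add_const (hfar p hfarp)]
      exact hb2 p hpS hnot hpF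
  have hi2' : ∀ p ∈ interior S, IsMCriticalPt (𝓡 4) Gn p → (mhessian (𝓡 4) Gn p).Nondegenerate := by
    intro p hpint hcrit
    rcases hdich p with ⟨hV₁, hr⟩ | hfarp
    · exact absurd hcrit (hnear p (interior_subset hpint) (fun hpF => hFnotint p hpF hpint) hV₁ hr)
    · rw [mhessian_congr_of_eventuallyEq_add_const (hfar p hfarp)]
      rw [isMCriticalPt_congr_of_eventuallyEq_add_const (hfar p hfarp)] at hcrit
      exact hi2 p hpint hcrit
  have hnocrit' : ∀ p ∈ S, p ∈ Oκ' → p ∉ F → ¬ IsMCriticalPt (𝓡 4) Gn p := by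
    rintro p hpS ⟨hpV₁, hpr⟩ hpF
    have hr : r2 p ≤ η := by have : r2 p < η / 2 := hpr; linarith
    exact hnear p hpS hpF hpV₁ hr
  have hc' : ∀ n, (interior S ∩ criticalSetOfIndex (𝓡 4) Gn n).ncard = c n := by
    intro n
    have hset : interior S ∩ criticalSetOfIndex (𝓡 4) Gn n = interior S ∩ criticalSetOfIndex (𝓡 4) G n := by
      ext p
      simp only [mem_inter_iff, mem_criticalSetOfIndex]
      constructor
      · rintro ⟨hpint, hcrit, hidx⟩
        rcases hdich p with ⟨hV₁, hr⟩ | hfarp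
        · exact absurd hcrit (hnear p (interior_subset hpint) (fun hpF => hFnotint p hpF hpint) hV₁ hr)
        · refine ⟨hpint, ?_, ?_⟩
          · rwa [isMCriticalPt_congr_of_eventuallyEq_add_const (hfar p hfarp)] at hcrit
          · unfold morseIndex at hidx ⊢
            rwa [mhessian_congr_of_eventuallyEq_add_const (hfar p hfarp)] at hidx
      · rintro ⟨hpint, hcrit, hidx⟩
        rcases hdich p with ⟨hV₁, hr⟩ | hfarp
        · exact absurd hcrit (hnear0 p (interior_subset hpint) (fun hpF => hFnotint p hpF hpint) hV₁ hr)
        · refine ⟨hpint, ?_, ?_⟩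
          · rwa [isMCriticalPt_congr_of_eventuallyEq_add_const (hfar p hfarp)]
          · unfold morseIndex at hidx ⊢
            rwa [mhessian_congr_of_eventuallyEq_add_const (hfar p hfarp)]
    rw [hset, hc n]
  -- ### the structure
  refine
    { isCompact := hSc
      mem_iff := hmem
      interior_iff := hint
      corner := hcorner
      half := hhalf
      morse := ⟨Gn, κ ∘ ρ, Oκ', hGns, hκs.comp hρs, hOκ'o, hFOκ', hOκ'O, fun y hy => ?_, fun y hy => ?_,
        fun y hy => ?_, hb1', hi1', hb2', hi2', hnocrit', hc'⟩ }
  · exact hκpos _ (hFOκ (hfr.ρ_mem _ (hOκ'O hy)))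
  · show κ (ρ (ρ y)) = κ (ρ y)
    rw [hfr.ρ_ρ (hOκ'O hy)]
  · rw [hformula y hy.1, hχone y hy]
    show _ = 1 - 2 * u y * v y * κ (ρ y)
    ring

end Renormalise

end Literature.Topology.FourManifolds
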